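import Summits.FinalStateConjecture.FinalStateConjecture.Theorems.ZeroEnergyKerrOrBombKerrOrBombDock
import Summits.FinalStateConjecture.FinalStateConjecture.Theorems.ZeroEnergyRigidity.Negative.CoreReduction

/-!
# Crux `KerrOrBomb` (stmt-FinalStateConjecture-10689) — the typed target is implied by `CoreRigidityGH`

Helper of the line lead c1 (prover-line-stmt-FinalStateConjecture-10689-c1-0, 2026-08-16), line `Dock`,
`--supports stmt-FinalStateConjecture-10689`: the kernel certificate behind the lead's hand-back
`verdict: misstated` (`Cruxes/KerrOrBomb/RESTATE.md`, `Cruxes/KerrOrBomb/Restate.lean`).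

`kerrOrBomb_of_core`: the route target `KerrOrBomb` AS TYPED follows from the statement
"every vacuum presentation `𝓑 : StationaryAFBlackHole` with connected, non-degenerate (global Killing
generator) future event horizon and globally hyperbolic carrier has d.o.c. isometric to a sub-extremal
Kerr exterior" — the sibling crux `ZeroEnergyRigidity` with its hypotheses h5 (`T ≠ 0` on the d.o.c.)
and h6 (no imprisoned zero-energy ray) deleted (`CoreRigidityGH`, inlined below verbatim as the
right-hand side of `ZeroEnergyRigidity.Negative.zeroEnergyRigidity_iff_core`, p95955) — by composing
that equivalence with the landed dock `KerrOrBombDock.kerrOrBomb_of_zeroEnergyRigidity` (p92061).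
So no proof of the typed target can spend its mode-stability hypothesis before `CoreRigidityGH`
(Hawking-rigid smooth stationary black-hole uniqueness for globally hyperbolic presentations, whose
residue — `I⁺`-regular re-presentation — is open in print) is settled: the typed "Kerr or bomb"
dichotomy is not exercised.  Pure logic over two landed theorems.
-/

noncomputable section

-- `Summit.FinalStateConjecture.FinalStateConjecture.…`: summit = problem name (single-conjunct summit, D-0017).
set_option linter.dupNamespace false

namespace Summit.FinalStateConjecture.FinalStateConjecture.Theorems.KerrOrBombDock

open Literature.Geometry.Lorentzian

/-- **Typed `KerrOrBomb` ⇐ `CoreRigidityGH`.**  If every vacuum stationary asymptotically flat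
black-hole presentation with connected non-degenerate horizon (global Killing generator) and globally
hyperbolic carrier has domain of outer communications isometric to a sub-extremal Kerr exterior, then
the route target `KerrOrBomb` holds — its hypotheses `T ≠ 0` on the d.o.c. and Killing-mode
stability are not needed (the former is a theorem under global hyperbolicity, the latter is idle).
Composition of `ZeroEnergyRigidity.Negative.zeroEnergyRigidity_iff_core` (p95955) with
`kerrOrBomb_of_zeroEnergyRigidity` (p92061). -/
theorem kerrOrBomb_of_core :
    (∀ (𝓑 : Literature.Geometry.Lorentzian.StationaryAFBlackHole.{0}) [𝓑.metric.HasLeviCivita] [Literature.Geometry.Lorentzian.Kerr.Facts], 𝓑.metric.toPseudoRiemannianMetric.IsRicciFlat → IsConnected 𝓑.horizon → 𝓑.toSpacetime.IsNonDegenerateHorizon 𝓑.Mext → 𝓑.metric.IsGloballyHyperbolic 𝓑.timeOrientation → ∃ (M a : ℝ), Literature.Geometry.Lorentzian.Kerr.IsSubextremal M a ∧ ∃ Ψ : Literature.Geometry.Lorentzian.Kerr.exterior M a → 𝓑.carrier, Function.Injective Ψ ∧ Set.range Ψ = 𝓑.doc ∧ Literature.Geometry.Lorentzian.PseudoRiemannianMetric.IsIsometricImmersion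 (Literature.Geometry.Lorentzian.Kerr.smoothMetric M a (Literature.Geometry.Lorentzian.Kerr.rPlus M a)).toPseudoRiemannianMetric 𝓑.metric.toPseudoRiemannianMetric Ψ) → Summit.FinalStateConjecture.FinalStateConjecture.Theses.ZeroEnergyKerrOrBomb.KerrOrBomb := fun h ↦
  kerrOrBomb_of_zeroEnergyRigidity (ZeroEnergyRigidity.Negative.zeroEnergyRigidity_iff_core.mpr h)

end Summit.FinalStateConjecture.FinalStateConjecture.Theorems.KerrOrBombDock

end
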